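import Summits.QuantumFields.QCD.Theses.WilsonQuarkChessboard
import Summits.QuantumFields.QCD.Theorems.WilsonQuarkChessboardQuarkChessboard
import Summits.QuantumFields.QCD.Theorems.WilsonQuarkChessboardFlatCellOptimalTilingFold

/-!
# Flat cell optimum: the gauge orbit of the flat cell (helper for crux stmt-QuantumFields-9307)

`N`-GENERIC facts about the two objects of the crux
`Summit.QuantumFields.QCD.Theses.WilsonQuarkChessboard.FlatCellOptimal` (and of both stubs of its
line `Cruxes/FlatCellOptimal/Lines/birth.lean`): the all-axes antiperiodic Wilson–Dirac determinant
`dAP m V = det D_W[seam V]` of a `U(N)` field (`seam` negates the links leaving the slice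
`x_μ = L − 1`) and the period-2 reflection tiling `tile c V` of the closed unit cell at `c`.
All statements are abstract in `dAP` / `tile`, which enter through their DEFINING EQUATIONS
(`hdAP` at a fixed mass, `htile`), so that the skeleton's reducible abbreviations `dAP m`, `tile` and the
crux's own `let dAP` / `let tile` are matched by `fun _ => rfl` / `fun _ _ _ => rfl`.

* `det_seam_gaugeTransform`, `apDet_gaugeTransform`, `apDet_tile_gaugeTransform`,
  `trace_plaquetteHolonomy_tile_gaugeTransform`: the seam twist commutes with gauge transformations
  (`-1` is central) and, for even `L`, the tiling of a gauge copy is a gauge copy of the tiling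
  (fold identity, sibling file `…FlatCellOptimalTilingFold`); hence `dAP m (tile c U^g) = dAP m (tile c U)`
  and the tiling's plaquette traces (deficits) are gauge invariant — for every colour number `N`.
* `apDet_tile_eq_of_flat` (**the equality case of the crux**): if every plaquette of the tiling
  `tile c U` has deficit `N − Re tr = 0`, then `dAP m (tile c U) = dAP m 1` — a plaquette-flat
  tiling is flat and link-odd, i.e. a gauge transform of the trivial field
  (`exists_eq_gaugeTransform_one`).  So `FlatCellOptimal` is TIGHT on the flat gauge orbit: no
  additive slack is available there, and its local half must be a genuine second-order statement.
* `apDet_one_re_nonneg_and_im`, `norm_apDet_one`: the free antiperiodic determinant is real and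
  `≥ 0` for `m > −1` (the proved `QuarkChessboard` at `U = 1`, whose tiling is `1`), so
  `‖dAP m 1‖ = Re dAP m 1`; `localFlatOptimum_of_normForm`: the local stub of the line follows from
  its NORM form `‖dAP m (tile c U)‖ ≤ ‖dAP m 1‖` (the shape produced by cell-gain estimates such as
  the sibling machinery `…CriticalLineDiamagnetism*`) on shrinking the mass window below `1`.

References: I. Montvay, G. Münster, *Quantum Fields on a Lattice* §4.2.4 (4.112)–(4.114)
(antiperiodic sign factors), §5.1.1 (5.3)–(5.5) (gauge invariance of the quark determinant);
M. Lüscher, Nucl. Phys. B 219 (1983) 233 §2 (torons).  Pure theorem file (no definitions).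
-/

noncomputable section

open scoped BigOperators Classical Matrix ComplexConjugate
open Literature.MathematicalPhysics.QuantumLattice Literature.MathematicalPhysics.QuantumFieldTheory

namespace Summit.QuantumFields.QCD.Cruxes.FlatCellOptimal.GaugeOrbit

open Summit.QuantumFields.QCD.Cruxes.CriticalLineDiamagnetism.ChessboardCellGain (seam_eq_apTwistAt')

variable {N L : ℕ}

/-! ### Gauge invariance of the all-axes antiperiodic determinant (every `N`) -/

/-- **Gauge invariance of `det D_W[seam V]`** for `U(N)` links, every `N`: the seam twist commutes
with gauge transformations and the Wilson fermion determinant is gauge invariant (the seam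
rewriting `seam_eq_apTwistAt'` is the sibling line's, `…StubQuarkChessboardOfSchwarzAux2`). -/
theorem det_seam_gaugeTransform [NeZero L] (g : Site 4 L → Matrix.unitaryGroup (Fin N) ℂ)
    (W : GaugeConfig 4 L (Matrix.unitaryGroup (Fin N) ℂ)) (m : ℝ) :
    (wilsonDirac (unitaryFundamentalRep (Fin N) ℂ)
        (fun e => if (e.1 e.2).val + 1 = L then -(gaugeTransform g W e) else gaugeTransform g W e)
        m 1).det =
      (wilsonDirac (unitaryFundamentalRep (Fin N) ℂ)
        (fun e => if (e.1 e.2).val + 1 = L then -W e else W e) m 1).det := by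
  rw [seam_eq_apTwistAt' (gaugeTransform g W), seam_eq_apTwistAt' W, apTwistAt_gaugeTransform]
  exact fermionDet_wilsonDirac_gaugeTransform _ g _ m 1

/-- `dAP (V^g) = dAP V`, abstractly in the items' `dAP` at a fixed mass `m` (given by its defining
equation `hdAP`; the crux's `let dAP` and the skeleton's `dAP m` both match by `fun _ => rfl`). -/
theorem apDet_gaugeTransform [NeZero L]
    {m : ℝ} {dAP : GaugeConfig 4 L (Matrix.unitaryGroup (Fin N) ℂ) → ℂ}
    (hdAP : ∀ V : GaugeConfig 4 L (Matrix.unitaryGroup (Fin N) ℂ), dAP V =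
      (wilsonDirac (unitaryFundamentalRep (Fin N) ℂ)
        (fun e => if (e.1 e.2).val + 1 = L then -V e else V e) m 1).det)
    (g : Site 4 L → Matrix.unitaryGroup (Fin N) ℂ) (V : GaugeConfig 4 L (Matrix.unitaryGroup (Fin N) ℂ)) :
    dAP (gaugeTransform g V) = dAP V := by
  rw [hdAP, hdAP]
  exact det_seam_gaugeTransform g V m

/-! ### Consequences for the crux objects (every `N`) -/

section Crux

variable [NeZero L] {m : ℝ}
  {dAP : GaugeConfig 4 L (Matrix.unitaryGroup (Fin N) ℂ) → ℂ}
  {tile : Site 4 L → GaugeConfig 4 L (Matrix.unitaryGroup (Fin N) ℂ) →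
    GaugeConfig 4 L (Matrix.unitaryGroup (Fin N) ℂ)}

/-- **`dAP ∘ tile_c` is gauge invariant** (even `L`, every `N`). -/
theorem apDet_tile_gaugeTransform (hL : Even L)
    (hdAP : ∀ V : GaugeConfig 4 L (Matrix.unitaryGroup (Fin N) ℂ), dAP V =
      (wilsonDirac (unitaryFundamentalRep (Fin N) ℂ)
        (fun e => if (e.1 e.2).val + 1 = L then -V e else V e) m 1).det)
    (htile : ∀ (c : Site 4 L) (V : GaugeConfig 4 L (Matrix.unitaryGroup (Fin N) ℂ)) (e : Edge 4 L),
      tile c V e = if (e.1 e.2 - c e.2).val % 2 = 0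
        then V (fun ν => c ν + (((e.1 ν - c ν).val % 2 : ℕ) : ZMod L), e.2)
        else (V (fun ν => c ν + (((Site.shift e.1 e.2 ν - c ν).val % 2 : ℕ) : ZMod L), e.2))⁻¹)
    (g : Site 4 L → Matrix.unitaryGroup (Fin N) ℂ) (U : GaugeConfig 4 L (Matrix.unitaryGroup (Fin N) ℂ))
    (c : Site 4 L) :
    dAP (tile c (gaugeTransform g U)) = dAP (tile c U) := by
  rw [tile_gaugeTransform hL htile g U c]
  exact apDet_gaugeTransform hdAP _ _

/-- **Plaquette traces (deficits) of the tiling are gauge invariant** (even `L`, every `N`). -/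
theorem trace_plaquetteHolonomy_tile_gaugeTransform (hL : Even L)
    (htile : ∀ (c : Site 4 L) (V : GaugeConfig 4 L (Matrix.unitaryGroup (Fin N) ℂ)) (e : Edge 4 L),
      tile c V e = if (e.1 e.2 - c e.2).val % 2 = 0
        then V (fun ν => c ν + (((e.1 ν - c ν).val % 2 : ℕ) : ZMod L), e.2)
        else (V (fun ν => c ν + (((Site.shift e.1 e.2 ν - c ν).val % 2 : ℕ) : ZMod L), e.2))⁻¹)
    (g : Site 4 L → Matrix.unitaryGroup (Fin N) ℂ) (U : GaugeConfig 4 L (Matrix.unitaryGroup (Fin N) ℂ))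
    (c x : Site 4 L) (i j : Fin 4) :
    ((unitaryFundamentalRep (Fin N) ℂ) (plaquetteHolonomy (tile c (gaugeTransform g U)) x i j)).trace =
      ((unitaryFundamentalRep (Fin N) ℂ) (plaquetteHolonomy (tile c U) x i j)).trace := by
  rw [tile_gaugeTransform hL htile g U c, plaquetteHolonomy_gaugeTransform, map_mul, map_mul,
    Matrix.trace_mul_cycle, ← map_mul, inv_mul_cancel, map_one, one_mul]

/-- **The equality case of the crux.** If every plaquette of the reflection tiling `tile_c U` is
trivial (deficit `0`), then `dAP (tile_c U) = dAP 1` (even `L`, every `N`, every mass `m`):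
the tiling is flat and link-odd, hence a gauge transform of the trivial field. -/
theorem apDet_tile_eq_of_flat (hL : Even L)
    (hdAP : ∀ V : GaugeConfig 4 L (Matrix.unitaryGroup (Fin N) ℂ), dAP V =
      (wilsonDirac (unitaryFundamentalRep (Fin N) ℂ)
        (fun e => if (e.1 e.2).val + 1 = L then -V e else V e) m 1).det)
    (htile : ∀ (c : Site 4 L) (V : GaugeConfig 4 L (Matrix.unitaryGroup (Fin N) ℂ)) (e : Edge 4 L),
      tile c V e = if (e.1 e.2 - c e.2).val % 2 = 0
        then V (fun ν => c ν + (((e.1 ν - c ν).val % 2 : ℕ) : ZMod L), e.2)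
        else (V (fun ν => c ν + (((Site.shift e.1 e.2 ν - c ν).val % 2 : ℕ) : ZMod L), e.2))⁻¹)
    (U : GaugeConfig 4 L (Matrix.unitaryGroup (Fin N) ℂ)) (c : Site 4 L)
    (hflat : ∀ (x : Site 4 L) (i j : Fin 4),
      (N : ℝ) - ((unitaryFundamentalRep (Fin N) ℂ) (plaquetteHolonomy (tile c U) x i j)).trace.re = 0) :
    dAP (tile c U) = dAP 1 := by
  obtain ⟨g, hg⟩ := exists_eq_gaugeTransform_one hL
    (fun x i j => (deficit_eq_zero_iff _).1 (hflat x i j)) (fun x μ => tile_mul_tile_shift hL htile U c x μ)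
  rw [hg]
  exact apDet_gaugeTransform hdAP g 1

/-- **The free antiperiodic determinant is real and non-negative** for `m > -1` (every `N`, even
`L ≥ 4`): the proved `QuarkChessboard` at `U = 1`, whose tiling is `1`. -/
theorem apDet_one_re_nonneg_and_im (hL : Even L) (h4 : 4 ≤ L)
    (hdAP : ∀ V : GaugeConfig 4 L (Matrix.unitaryGroup (Fin N) ℂ), dAP V =
      (wilsonDirac (unitaryFundamentalRep (Fin N) ℂ)
        (fun e => if (e.1 e.2).val + 1 = L then -V e else V e) m 1).det)
    (hm : -1 < m) : 0 ≤ (dAP 1).re ∧ (dAP 1).im = 0 := by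
  have hQC := Summit.QuantumFields.QCD.Theorems.wilsonQuarkChessboardQuarkChessboard_proof N L hL h4
    (1 : GaugeConfig 4 L (Matrix.unitaryGroup (Fin N) ℂ)) m hm
  obtain ⟨hReal, -⟩ := hQC
  have h1 := hReal (0 : Site 4 L)
  simpa [hdAP] using h1

/-- `‖dAP 1‖ = Re dAP 1` for `m > -1`. -/
theorem norm_apDet_one (hL : Even L) (h4 : 4 ≤ L)
    (hdAP : ∀ V : GaugeConfig 4 L (Matrix.unitaryGroup (Fin N) ℂ), dAP V =
      (wilsonDirac (unitaryFundamentalRep (Fin N) ℂ)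
        (fun e => if (e.1 e.2).val + 1 = L then -V e else V e) m 1).det)
    (hm : -1 < m) : ‖dAP 1‖ = (dAP 1).re := by
  obtain ⟨hre, him⟩ := apDet_one_re_nonneg_and_im hL h4 hdAP hm
  have hz : dAP 1 = (((dAP 1).re : ℝ) : ℂ) := Complex.ext (by simp) (by simp [him])
  rw [hz]
  simp [abs_of_nonneg hre]

/-- From the norm form to the crux form: `‖dAP V‖ ≤ ‖dAP 1‖ ⇒ Re dAP V ≤ Re dAP 1`. -/
theorem re_le_re_of_norm_le (hL : Even L) (h4 : 4 ≤ L)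
    (hdAP : ∀ V : GaugeConfig 4 L (Matrix.unitaryGroup (Fin N) ℂ), dAP V =
      (wilsonDirac (unitaryFundamentalRep (Fin N) ℂ)
        (fun e => if (e.1 e.2).val + 1 = L then -V e else V e) m 1).det)
    (hm : -1 < m) (V : GaugeConfig 4 L (Matrix.unitaryGroup (Fin N) ℂ))
    (h : ‖dAP V‖ ≤ ‖dAP 1‖) : (dAP V).re ≤ (dAP 1).re :=
  ((Complex.re_le_norm _).trans h).trans_eq (norm_apDet_one hL h4 hdAP hm)

end Crux

/-! ### The local stub in norm form implies the local stub -/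

/-- **Norm form ⇒ `LocalFlatOptimum`.** The local stub of the line (`stub_localFlatOptimum`, here
spelled out literally) follows from the same statement with conclusion
`‖dAP m (tile c U)‖ ≤ ‖dAP m 1‖` — the shape delivered by cell-gain estimates — on shrinking the
mass window below `1` (so that `m > -1` and the free determinant is real `≥ 0`). -/
theorem localFlatOptimum_of_normForm
    (H : ∃ η : ℝ, 0 < η ∧ ∃ δ : ℝ, 0 < δ ∧ ∀ (N L : ℕ) [NeZero L], Even L → 4 ≤ L →
      ∀ (U : GaugeConfig 4 L (Matrix.unitaryGroup (Fin N) ℂ)) (c : Site 4 L) (m : ℝ), -δ < m → m < δ →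
        (∀ (x : Site 4 L) (i j : Fin 4), (N : ℝ) - ((unitaryFundamentalRep (Fin N) ℂ) (plaquetteHolonomy
          (fun e : Edge 4 L => if (e.1 e.2 - c e.2).val % 2 = 0
            then U (fun ν => c ν + (((e.1 ν - c ν).val % 2 : ℕ) : ZMod L), e.2)
            else (U (fun ν => c ν + (((Site.shift e.1 e.2 ν - c ν).val % 2 : ℕ) : ZMod L), e.2))⁻¹)
          x i j)).trace.re < η) →
        ‖(wilsonDirac (unitaryFundamentalRep (Fin N) ℂ) (fun e : Edge 4 L => if (e.1 e.2).val + 1 = L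
            then -((fun e : Edge 4 L => if (e.1 e.2 - c e.2).val % 2 = 0
              then U (fun ν => c ν + (((e.1 ν - c ν).val % 2 : ℕ) : ZMod L), e.2)
              else (U (fun ν => c ν + (((Site.shift e.1 e.2 ν - c ν).val % 2 : ℕ) : ZMod L), e.2))⁻¹) e)
            else (fun e : Edge 4 L => if (e.1 e.2 - c e.2).val % 2 = 0
              then U (fun ν => c ν + (((e.1 ν - c ν).val % 2 : ℕ) : ZMod L), e.2)
              else (U (fun ν => c ν + (((Site.shift e.1 e.2 ν - c ν).val % 2 : ℕ) : ZMod L), e.2))⁻¹) e)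
            m 1).det‖ ≤
        ‖(wilsonDirac (unitaryFundamentalRep (Fin N) ℂ) (fun e : Edge 4 L => if (e.1 e.2).val + 1 = L
            then -(1 : GaugeConfig 4 L (Matrix.unitaryGroup (Fin N) ℂ)) e
            else (1 : GaugeConfig 4 L (Matrix.unitaryGroup (Fin N) ℂ)) e) m 1).det‖) :
    ∃ η : ℝ, 0 < η ∧ ∃ δ : ℝ, 0 < δ ∧ ∀ (N L : ℕ) [NeZero L], Even L → 4 ≤ L →
      ∀ (U : GaugeConfig 4 L (Matrix.unitaryGroup (Fin N) ℂ)) (c : Site 4 L) (m : ℝ), -δ < m → m < δ →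
        (∀ (x : Site 4 L) (i j : Fin 4), (N : ℝ) - ((unitaryFundamentalRep (Fin N) ℂ) (plaquetteHolonomy
          (fun e : Edge 4 L => if (e.1 e.2 - c e.2).val % 2 = 0
            then U (fun ν => c ν + (((e.1 ν - c ν).val % 2 : ℕ) : ZMod L), e.2)
            else (U (fun ν => c ν + (((Site.shift e.1 e.2 ν - c ν).val % 2 : ℕ) : ZMod L), e.2))⁻¹)
          x i j)).trace.re < η) →
        ((wilsonDirac (unitaryFundamentalRep (Fin N) ℂ) (fun e : Edge 4 L => if (e.1 e.2).val + 1 = L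
            then -((fun e : Edge 4 L => if (e.1 e.2 - c e.2).val % 2 = 0
              then U (fun ν => c ν + (((e.1 ν - c ν).val % 2 : ℕ) : ZMod L), e.2)
              else (U (fun ν => c ν + (((Site.shift e.1 e.2 ν - c ν).val % 2 : ℕ) : ZMod L), e.2))⁻¹) e)
            else (fun e : Edge 4 L => if (e.1 e.2 - c e.2).val % 2 = 0
              then U (fun ν => c ν + (((e.1 ν - c ν).val % 2 : ℕ) : ZMod L), e.2)
              else (U (fun ν => c ν + (((Site.shift e.1 e.2 ν - c ν).val % 2 : ℕ) : ZMod L), e.2))⁻¹) e)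
            m 1).det).re ≤
        ((wilsonDirac (unitaryFundamentalRep (Fin N) ℂ) (fun e : Edge 4 L => if (e.1 e.2).val + 1 = L
            then -(1 : GaugeConfig 4 L (Matrix.unitaryGroup (Fin N) ℂ)) e
            else (1 : GaugeConfig 4 L (Matrix.unitaryGroup (Fin N) ℂ)) e) m 1).det).re := by
  obtain ⟨η, hη, δ, hδ, H⟩ := H
  refine ⟨η, hη, min δ 1, lt_min hδ one_pos, ?_⟩
  intro N L _ hL h4 U c m hm₁ hm₂ hflat
  have hm₁' : -δ < m := lt_of_le_of_lt (neg_le_neg (min_le_left δ 1)) hm₁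
  have hm₂' : m < δ := lt_of_lt_of_le hm₂ (min_le_left δ 1)
  have hm1 : -1 < m := lt_of_le_of_lt (neg_le_neg (min_le_right δ 1)) hm₁
  have key := H N L hL h4 U c m hm₁' hm₂' hflat
  exact re_le_re_of_norm_le (N := N) (L := L)
    (dAP := fun V => (wilsonDirac (unitaryFundamentalRep (Fin N) ℂ)
      (fun e => if (e.1 e.2).val + 1 = L then -V e else V e) m 1).det)
    hL h4 (fun _ => rfl) hm1 _ key

/-- **Registered sub-goal of this helper file** (`stub_apDetTileEqOfFlat`, crux stmt-QuantumFields-9307) —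
the EQUALITY CASE of `FlatCellOptimal` in the crux's own `let dAP` / `let tile`: for every `N`, even `L` and
every mass, a reflection tiling all of whose plaquette deficits vanish has the free antiperiodic determinant. -/
theorem stub_apDetTileEqOfFlat : ∀ (N L : ℕ) [NeZero L], Even L → ∀ (U : Literature.MathematicalPhysics.QuantumFieldTheory.GaugeConfig 4 L (Matrix.unitaryGroup (Fin N) ℂ)) (c : Literature.MathematicalPhysics.QuantumFieldTheory.Site 4 L) (m : ℝ), let dAP : Literature.MathematicalPhysics.QuantumFieldTheory.GaugeConfig 4 L (Matrix.unitaryGroup (Fin N) ℂ) → ℂ := fun V => (Literature.MathematicalPhysics.QuantumLattice.wilsonDirac (Literature.MathematicalPhysics.QuantumLattice.unitaryFundamentalRep (Fin N) ℂ) (fun e => if (e.1 e.2).val + 1 = L then -V e else V e) m 1).det; let tile : Literature.MathematicalPhysics.QuantumFieldTheory.Site 4 L → Literature.MathematicalPhysics.QuantumFieldTheory.GaugeConfig 4 L (Matrix.unitaryGroup (Fin N) ℂ) → Literature.MathematicalPhysics.QuantumFieldTheory.GaugeConfig 4 L (Matrix.unitaryGroup (Fin N) ℂ) := fun c V e =>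 if (e.1 e.2 - c e.2).val % 2 = 0 then V (fun ν => c ν + (((e.1 ν - c ν).val % 2 : ℕ) : ZMod L), e.2) else (V (fun ν => c ν + (((Literature.MathematicalPhysics.QuantumFieldTheory.Site.shift e.1 e.2 ν - c ν).val % 2 : ℕ) : ZMod L), e.2))⁻¹; (∀ (x : Literature.MathematicalPhysics.QuantumFieldTheory.Site 4 L) (i j : Fin 4), (N : ℝ) - ((Literature.MathematicalPhysics.QuantumLattice.unitaryFundamentalRep (Fin N) ℂ) (Literature.MathematicalPhysics.QuantumFieldTheory.plaquetteHolonomy (tile c U) x i j)).trace.re = 0) → dAP (tile c U) = dAP 1 := by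
  intro N L _ hL U c m dAP tile hflat
  exact apDet_tile_eq_of_flat (dAP := dAP) (tile := tile) hL (fun _ => rfl) (fun _ _ _ => rfl) U c hflat

end Summit.QuantumFields.QCD.Cruxes.FlatCellOptimal.GaugeOrbit

end
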